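/- LEAD seat `ym-line-cbag-p1` (prover-ym-line-cbag-p1-g29-0), LINE 7b (`GlueballBandRecursion`, volume-comparison line): the ASSEMBLY of the line —
`ThermalFreeEnergyVolumeJets → TraceExcessFloorAllSides → TraceExcessVolumeComparisonSmallCoupling` (Schwarz lemma with multiplicity on the
strong-coupling disc + the volume-uniform floor), hence `→ ColdDoublingRecursionSmallCoupling`.  Sorry-free; `--supports stmt-QuantumFields-22957 --as helper`. -/
import Summits.QuantumFields.YangMills.Theorems.GlueballBandRecursionThermalFreeEnergyAnalytic
import Summits.QuantumFields.YangMills.Theorems.GlueballBandRecursionRungOfVolumeComparison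
import Summits.QuantumFields.YangMills.Theorems.GlueballBandRecursionRateToolkit
import Summits.QuantumFields.YangMills.Theorems.GlueballBandRecursionEscapeAtZeroCoupling
import Literature.LinearAlgebra.Matrix.TraceSingularValueInequality
import HarnessLib

/-!
# Route `GlueballBandRecursion`, line 7b: the volume comparison of the cold trace excess from jet agreement (assembly)

With `x_t(N) = traceExcess r.ρ β N t`, `g = log(1+x_t(L))`, `g' = log(1+x_t(L'))` (`t = ⌊L/4⌋ = m + 2`, `2L ≤ L' ≤ 4L`) and the real part `D` of
`volumeDiscrepancy r.ρ L L' t β` (`= g'/L'³ − g/L³`, `…ThermalFreeEnergyAnalytic`):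

* scalar lemmas (`1536L⁴ ≤ 4^L` for `L ≥ 16`; the budget `64L³·24t·(β/(r/2))^{3L} ≤ (cβ)^L` once `8β²/(r³c) ≤ 1/4`;
  `(cβ)^L ≤ (cβ⁴)^t` for `4t ≤ L`; `g' ≤ 64g + η` from `64L³|D| ≤ η`; `x' ≤ 65e²x` from `g' ≤ 64g + η ≤ 65x`);
* `traceExcessVolumeComparisonSmallCoupling_of_jets : ThermalFreeEnergyVolumeJets → TraceExcessFloorAllSides → TraceExcessVolumeComparisonSmallCoupling`
  (`K = 65e²`; window `β₁ = min(r_ρ/2, βF, 1, √(r_ρ³c/32))`, `c = min c₁ 1`; sides `L ≥ max(N₀, L₁, 16)`): the jets give `|D| ≤ 24t(2β/r_ρ)^{3L}`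
  (Schwarz), the budget and the floor give `64L³|D| ≤ (cβ)^L ≤ (cβ⁴)^t ≤ x_t(L)`, so `g' ≤ 64g + x ≤ 65x` and `x_t(L') = e^{g'} − 1 ≤ 65e²x_t(L)`; trivial
  `G` and `β = 0` by `traceExcess = 0` (`…EscapeAtZeroCoupling`);
* `coldDoublingRecursionSmallCoupling_of_jets` — through `coldDoublingRecursionSmallCoupling_of_volumeComparison`.

So line 7b's ∃-window rung hangs, kernel-checked, on the jet stub `ThermalFreeEnergyVolumeJets` (finite combinatorics of Haar joint cumulants on periodic
boxes: closedness + slab count + lifting) and the all-sides floor `TraceExcessFloorAllSides` (the IR cell's engine, all sides).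

HONEST FRAMING.  Implications only; the two hypotheses are OPEN here; the target is a RECORD-type strong-coupling rung; nothing bears on weak coupling or on
the Yang–Mills mass gap (Clay), which is NOT proved by anything in this file.
-/

set_option autoImplicit false

noncomputable section

open Filter Topology Asymptotics MeasureTheory
open Literature.Probability.LatticeModels (pertLogZ)
open Literature.MathematicalPhysics.QuantumFieldTheory
open Literature.MathematicalPhysics.QuantumFieldTheory.Balaban1983to89.Missing

namespace Summit.QuantumFields.YangMills.Theorems.GlueballBandRecursion.Thermal

/-! ## §4 Assembly: jets ∧ floor ⇒ the volume comparison at small coupling ⇒ the ∃-window rung -/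

section Scalar

/-- `1536 L⁴ ≤ 4^L` for `L ≥ 16`. -/
theorem aux_pow_four_le (L : ℕ) (hL : 16 ≤ L) : 1536 * L ^ 4 ≤ 4 ^ L := by
  induction L, hL using Nat.le_induction with
  | base => norm_num
  | succ k hk ih =>
    have hk' : 16 ≤ k := hk
    have h4 : k ^ 4 = k * k ^ 3 := by ring
    have h16 : 16 * k ^ 3 ≤ k ^ 4 := by rw [h4]; exact Nat.mul_le_mul_right _ hk'
    have hk2 : k ^ 2 ≤ k ^ 3 := Nat.pow_le_pow_right (by omega) (by omega)
    have hk1 : k ≤ k ^ 3 := by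
      calc k = k ^ 1 := (pow_one k).symm
        _ ≤ k ^ 3 := Nat.pow_le_pow_right (by omega) (by omega)
    have hk0 : 1 ≤ k ^ 3 := Nat.one_le_pow _ _ (by omega)
    have hexp : (k + 1) ^ 4 = k ^ 4 + 4 * k ^ 3 + 6 * k ^ 2 + 4 * k + 1 := by ring
    have h3 : (k + 1) ^ 4 ≤ 4 * k ^ 4 := by rw [hexp]; linarith
    calc 1536 * (k + 1) ^ 4 ≤ 1536 * (4 * k ^ 4) := Nat.mul_le_mul_left _ h3
      _ = 4 * (1536 * k ^ 4) := by ring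
      _ ≤ 4 * 4 ^ k := Nat.mul_le_mul_left _ ih
      _ = 4 ^ (k + 1) := by ring

/-- The comparison budget: `64L³·24t·(β/(r/2))^{3L} ≤ (cβ)^L` once `8β²/(r³c) ≤ 1/4`, `t ≤ L`, `L ≥ 16`
(`= 1536L³t·(8β²/(r³c))^L·(cβ)^L ≤ 1536L⁴4^{−L}(cβ)^L`). -/
theorem budget_le_pow {β r c : ℝ} {L t : ℕ} (hβ0 : 0 ≤ β) (hr0 : 0 < r) (hc0 : 0 < c)
    (hratio : 8 * β ^ 2 / (r ^ 3 * c) ≤ 1 / 4) (htL : t ≤ L) (hL16 : 16 ≤ L) :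
    64 * (L : ℝ) ^ 3 * (24 * (t : ℝ) * (β / (r / 2)) ^ (3 * L)) ≤ (c * β) ^ L := by
  have htL' : (t : ℝ) ≤ (L : ℝ) := by exact_mod_cast htL
  have hpow : (β / (r / 2)) ^ (3 * L) = (8 * β ^ 3 / r ^ 3) ^ L := by
    rw [pow_mul]; congr 1; field_simp; ring
  have hsplit : (8 * β ^ 3 / r ^ 3) ^ L = (8 * β ^ 2 / (r ^ 3 * c)) ^ L * (c * β) ^ L := by
    rw [← mul_pow]; congr 1; field_simp
  have hgeom : (8 * β ^ 2 / (r ^ 3 * c)) ^ L ≤ (1 / 4) ^ L := pow_le_pow_left₀ (by positivity) hratio L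
  have hcount : (1536 : ℝ) * (L : ℝ) ^ 4 * (1 / 4) ^ L ≤ 1 := by
    have h := aux_pow_four_le L hL16
    have h' : ((1536 * L ^ 4 : ℕ) : ℝ) ≤ ((4 ^ L : ℕ) : ℝ) := by exact_mod_cast h
    push_cast at h'
    have h4 : (0 : ℝ) < 4 ^ L := by positivity
    rw [one_div, inv_pow, ← div_eq_mul_inv, div_le_one h4]
    exact h'
  have hcβ : 0 ≤ (c * β) ^ L := by positivity
  calc 64 * (L : ℝ) ^ 3 * (24 * (t : ℝ) * (β / (r / 2)) ^ (3 * L))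
      = 64 * (L : ℝ) ^ 3 * (24 * (t : ℝ)) * (8 * β ^ 3 / r ^ 3) ^ L := by rw [hpow]; ring
    _ ≤ 64 * (L : ℝ) ^ 3 * (24 * (L : ℝ)) * (8 * β ^ 3 / r ^ 3) ^ L := by gcongr
    _ = 1536 * (L : ℝ) ^ 4 * ((8 * β ^ 2 / (r ^ 3 * c)) ^ L * (c * β) ^ L) := by rw [hsplit]; ring
    _ ≤ 1536 * (L : ℝ) ^ 4 * ((1 / 4) ^ L * (c * β) ^ L) := by gcongr
    _ = (1536 * (L : ℝ) ^ 4 * (1 / 4) ^ L) * (c * β) ^ L := by ring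
    _ ≤ 1 * (c * β) ^ L := mul_le_mul_of_nonneg_right hcount hcβ
    _ = (c * β) ^ L := one_mul _

/-- `(cβ)^L ≤ (cβ⁴)^t` for `c, β ∈ [0, 1]`, `t ≤ L`, `4t ≤ L`. -/
theorem pow_le_floor {β c : ℝ} {L t : ℕ} (hc0 : 0 ≤ c) (hc1 : c ≤ 1) (hβ0 : 0 ≤ β) (hβ1 : β ≤ 1) (htL : t ≤ L)
    (h4t : 4 * t ≤ L) : (c * β) ^ L ≤ (c * β ^ 4) ^ t := by
  rw [mul_pow, mul_pow, ← pow_mul]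
  exact mul_le_mul (pow_le_pow_of_le_one hc0 hc1 htL) (pow_le_pow_of_le_one hβ0 hβ1 (by omega)) (by positivity)
    (by positivity)

/-- The free-energy bookkeeping: from `D = g'/L'³ − g/L³`, `L' ≤ 4L`, `0 ≤ g` and `64L³|D| ≤ η` conclude `g' ≤ 64g + η`. -/
theorem log_le_of_discrepancy {g g' D η : ℝ} {L L' : ℕ} (hL : 0 < L) (hL'L : L' ≤ 4 * L) (hg0 : 0 ≤ g)
    (hDeq : D = g' / (L' : ℝ) ^ 3 - g / (L : ℝ) ^ 3) (hL' : 0 < L') (hDη : 64 * (L : ℝ) ^ 3 * |D| ≤ η) :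
    g' ≤ 64 * g + η := by
  have hL3 : (0 : ℝ) < (L : ℝ) ^ 3 := by positivity
  have hL'3 : (0 : ℝ) < (L' : ℝ) ^ 3 := by positivity
  have hratio3 : (L' : ℝ) ^ 3 ≤ 64 * (L : ℝ) ^ 3 := by
    have h : (L' : ℝ) ≤ 4 * L := by exact_mod_cast hL'L
    have h0 : (0 : ℝ) ≤ L' := Nat.cast_nonneg _
    calc (L' : ℝ) ^ 3 ≤ (4 * (L : ℝ)) ^ 3 := pow_le_pow_left₀ h0 h 3
      _ = 64 * (L : ℝ) ^ 3 := by ring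
  have hg'eq : g' = (L' : ℝ) ^ 3 * (g / (L : ℝ) ^ 3) + (L' : ℝ) ^ 3 * D := by
    rw [hDeq]; field_simp; ring
  rw [hg'eq]
  have h1 : (L' : ℝ) ^ 3 * (g / (L : ℝ) ^ 3) ≤ 64 * g := by
    rw [← mul_div_assoc, div_le_iff₀ hL3]; nlinarith [hratio3, hg0]
  have h2 : (L' : ℝ) ^ 3 * D ≤ η := by
    calc (L' : ℝ) ^ 3 * D ≤ (L' : ℝ) ^ 3 * |D| := mul_le_mul_of_nonneg_left (le_abs_self D) hL'3.le
      _ ≤ 64 * (L : ℝ) ^ 3 * |D| := mul_le_mul_of_nonneg_right hratio3 (abs_nonneg D)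
      _ ≤ η := hDη
  linarith

/-- The exponential bookkeeping: `g ≤ x ≤ 1/64`, `g' ≤ 64g + η`, `η ≤ x`, `0 ≤ g'`, `x' = e^{g'} − 1` give `x' ≤ 65e²·x`. -/
theorem excess_le_of_log_le {x x' g g' η : ℝ} (hx64 : x ≤ 1 / 64) (hgx : g ≤ x) (hg'le : g' ≤ 64 * g + η) (hηx : η ≤ x)
    (hg'0 : 0 ≤ g') (hx' : x' = Real.exp g' - 1) : x' ≤ 65 * Real.exp 2 * x := by
  have hg'65 : g' ≤ 65 * x := by linarith
  have hg'2 : g' ≤ 2 := by linarith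
  have hx0 : 0 ≤ x := by linarith
  -- `e^y − 1 ≤ y·e^y` (from `1 − y ≤ e^{−y}`; also `AreaLaw.exp_sub_one_le_mul_exp` in the tree)
  have hexp : Real.exp g' - 1 ≤ g' * Real.exp g' := by
    have h := Real.add_one_le_exp (-g')
    have hpos := Real.exp_pos g'
    have h2 : Real.exp (-g') * Real.exp g' = 1 := by rw [← Real.exp_add, neg_add_cancel, Real.exp_zero]
    nlinarith [mul_le_mul_of_nonneg_right h hpos.le]
  rw [hx']
  calc Real.exp g' - 1 ≤ g' * Real.exp g' := hexp
    _ ≤ (65 * x) * Real.exp 2 := mul_le_mul hg'65 (Real.exp_le_exp.2 hg'2) (Real.exp_pos _).le (by positivity)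
    _ = 65 * Real.exp 2 * x := by ring

end Scalar

/-- A faithful unitary representation of a nontrivial group has non-constant real character (`Re tr U = n` forces a unitary `U = 1`). -/
theorem latticeRep_re_trace_nonconst_of_nontrivial {G : Type} [Group G] [TopologicalSpace G] [Nontrivial G] (r : LatticeRep G) :
    ∃ g h : G, (r.ρ g).trace.re ≠ (r.ρ h).trace.re := by
  obtain ⟨a, ha⟩ := exists_ne (1 : G)
  refine ⟨a, 1, fun h => ha (r.injective ?_)⟩
  rw [map_one]
  have hN : ((r.ρ 1).trace).re = (Fintype.card (Fin r.N) : ℝ) := by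
    rw [map_one, Matrix.trace_one, Fintype.card_fin]
    simp
  rw [hN] at h
  have h' : RCLike.re (Matrix.trace (r.ρ a)) = Fintype.card (Fin r.N) := by
    simpa using h
  exact (Literature.LinearAlgebra.Matrix.re_trace_eq_card_iff_of_mem_unitaryGroup (r.mem_unitary a)).1 h'

section RealDiscrepancy

variable {G : Type*} [Group G] [TopologicalSpace G] [IsTopologicalGroup G] [CompactSpace G] [MeasurableSpace G] [BorelSpace G]
  [SecondCountableTopology G] {n : ℕ} (ρ : G →* Matrix (Fin n) (Fin n) ℂ)

/-- At real `β ∈ [0, r_ρ]` the real part of the volume discrepancy is the difference of the thermal free-energy densities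
`log(1+x_{m+2}(L'))/L'³ − log(1+x_{m+2}(L))/L³`. -/
theorem re_volumeDiscrepancy_ofReal (hρ : Continuous ρ) (hρu : ∀ g, ρ g ∈ Matrix.unitaryGroup (Fin n) ℂ) {β : ℝ} (hβ0 : 0 ≤ β)
    (hβ : β ≤ strongCouplingRadius ρ) (L L' m : ℕ) [NeZero L] [NeZero L'] :
    (volumeDiscrepancy ρ L L' (m + 2) (β : ℂ)).re =
      Real.log (1 + traceExcess ρ β L' (m + 2)) / (L' : ℝ) ^ 3 - Real.log (1 + traceExcess ρ β L (m + 2)) / (L : ℝ) ^ 3 := by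
  have e1 : ((L' : ℂ) ^ 3) = (((L' : ℝ) ^ 3 : ℝ) : ℂ) := by push_cast; ring
  have e2 : ((L : ℂ) ^ 3) = (((L : ℝ) ^ 3 : ℝ) : ℂ) := by push_cast; ring
  unfold volumeDiscrepancy
  rw [Complex.sub_re, e1, e2, Complex.div_ofReal_re, Complex.div_ofReal_re, re_thermalLogZ_ofReal ρ hρ hρu hβ0 hβ L m,
    re_thermalLogZ_ofReal ρ hρ hρu hβ0 hβ L' m]

end RealDiscrepancy

/-- **THE ASSEMBLY OF LINE 7b: `ThermalFreeEnergyVolumeJets → TraceExcessFloorAllSides → TraceExcessVolumeComparisonSmallCoupling`.**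
Window `β₁ = min(r_ρ/2, βF, 1, √(r_ρ³c/32))` with `c = min c₁ 1`; constant `K = 65e²`; sides `L ≥ max(N₀, L₁, 16)`; see the module docstring for the
four-line estimate.  Only the implication is proved; both hypotheses are OPEN; no mass gap is claimed. -/
theorem traceExcessVolumeComparisonSmallCoupling_of_jets (hJ : ThermalFreeEnergyVolumeJets) (hF : TraceExcessFloorAllSides) :
    TraceExcessVolumeComparisonSmallCoupling := by
  intro G _ _ _ _
  letI : MeasurableSpace G := borel G
  haveI : BorelSpace G := ⟨rfl⟩
  intro r
  haveI : SecondCountableTopology G :=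
    (r.continuous.isClosedEmbedding r.injective).isEmbedding.secondCountableTopology
  rcases subsingleton_or_nontrivial G with hG | hG
  · -- trivial group: the trace excess vanishes identically
    refine ⟨1, one_pos, 0, le_rfl, 0, fun β _ _ L _ L' _ m _ _ _ _ => ?_⟩
    rw [Escape.traceExcess_eq_zero_of_subsingleton r.ρ β (m + 2), Escape.traceExcess_eq_zero_of_subsingleton r.ρ β (m + 2),
      mul_zero]
  -- nontrivial group: floor + jets
  obtain ⟨βF, c₁, N₀, hβF, hc₁, hfl⟩ := hF G r (latticeRep_re_trace_nonconst_of_nontrivial r)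
  obtain ⟨L₁, hL₁⟩ := Rate.traceExcess_small_of_large r.continuous r.mem_unitary (ε := 1 / 64) (by norm_num)
  have hr0 : 0 < strongCouplingRadius r.ρ := strongCouplingRadius_pos r.ρ
  have hc0 : 0 < min c₁ 1 := lt_min hc₁ one_pos
  have hβ₁pos : 0 < min (strongCouplingRadius r.ρ / 2) (min βF (min 1 (Real.sqrt (strongCouplingRadius r.ρ ^ 3 * min c₁ 1 / 32)))) :=
    lt_min (half_pos hr0) (lt_min hβF (lt_min one_pos (Real.sqrt_pos.2 (by positivity))))
  refine ⟨_, hβ₁pos, 65 * Real.exp 2, by positivity, max N₀ (max L₁ 16), ?_⟩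
  intro β hβ0 hβ L _ L' _ m hm hL hLL' hL'L
  -- unpack the window and the side threshold
  set rr : ℝ := strongCouplingRadius r.ρ with hrr
  set c : ℝ := min c₁ 1 with hcdef
  have hc1 : c ≤ 1 := min_le_right _ _
  have hcc₁ : c ≤ c₁ := min_le_left _ _
  have hN₀L : N₀ ≤ L := le_trans (le_max_left _ _) hL
  have hL₁L : L₁ ≤ L := le_trans ((le_max_left _ _).trans (le_max_right _ _)) hL
  have hL16 : 16 ≤ L := le_trans ((le_max_right _ _).trans (le_max_right _ _)) hL
  have hβr2 : β ≤ rr / 2 := hβ.trans (min_le_left _ _)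
  have hββF : β ≤ βF := hβ.trans ((min_le_right _ _).trans (min_le_left _ _))
  have hβ1 : β ≤ 1 := hβ.trans ((min_le_right _ _).trans ((min_le_right _ _).trans (min_le_left _ _)))
  have hβsq : β ≤ Real.sqrt (rr ^ 3 * c / 32) :=
    hβ.trans ((min_le_right _ _).trans ((min_le_right _ _).trans (min_le_right _ _)))
  have hβr : β ≤ rr := by linarith
  -- `β = 0`: both sides vanish
  rcases hβ0.eq_or_lt with rfl | hβpos
  · rw [Escape.traceExcess_zero r.ρ (m + 2), Escape.traceExcess_zero r.ρ (m + 2), mul_zero]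
  have ht4 : 4 ≤ m + 2 := by omega
  have h4t : 4 * (m + 2) ≤ L := by omega
  have htL : m + 2 ≤ L := by omega
  have hLpos : 0 < L := by omega
  have hL'pos : 0 < L' := by omega
  -- the thermal excesses
  have hx0 : 0 ≤ traceExcess r.ρ β L (m + 2) := Rate.traceExcess_nonneg r.continuous r.mem_unitary hβ0 L m
  have hx'0 : 0 ≤ traceExcess r.ρ β L' (m + 2) := Rate.traceExcess_nonneg r.continuous r.mem_unitary hβ0 L' m
  have hx64 : traceExcess r.ρ β L (m + 2) ≤ 1 / 64 := hL₁ β hβ0 hβr L m hm hL₁L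
  have hg0 : 0 ≤ Real.log (1 + traceExcess r.ρ β L (m + 2)) := Real.log_nonneg (by linarith)
  have hg'0 : 0 ≤ Real.log (1 + traceExcess r.ρ β L' (m + 2)) := Real.log_nonneg (by linarith)
  have hgx : Real.log (1 + traceExcess r.ρ β L (m + 2)) ≤ traceExcess r.ρ β L (m + 2) := by
    have := Real.log_le_sub_one_of_pos (show 0 < 1 + traceExcess r.ρ β L (m + 2) by linarith)
    linarith
  -- the discrepancy at real `β`: identity and Schwarz bound
  have hDeq := re_volumeDiscrepancy_ofReal r.ρ r.continuous r.mem_unitary hβ0 hβr L L' m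
  have hO := hJ G r L L' (m + 2) (by omega) (by omega) ht4
  have hz : ‖(β : ℂ)‖ ≤ strongCouplingRadius r.ρ / 2 := by
    rw [Complex.norm_real, Real.norm_eq_abs, abs_of_nonneg hβ0]; exact hβr2
  have hDn := norm_volumeDiscrepancy_le_of_isBigO r.ρ r.continuous hLpos hL'pos (by omega) hO hz
  rw [Complex.norm_real, Real.norm_eq_abs, abs_of_nonneg hβ0] at hDn
  have hDabs : |(volumeDiscrepancy r.ρ L L' (m + 2) (β : ℂ)).re| ≤ 24 * ((m + 2 : ℕ) : ℝ) * (β / (rr / 2)) ^ (3 * L) :=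
    (Complex.abs_re_le_norm _).trans hDn
  -- the budget `64L³·|D| ≤ (cβ)^L ≤ (cβ⁴)^t ≤ x`
  have hratio : 8 * β ^ 2 / (rr ^ 3 * c) ≤ 1 / 4 := by
    have h1 : β ^ 2 ≤ rr ^ 3 * c / 32 := by
      have h := Real.sq_sqrt (show 0 ≤ rr ^ 3 * c / 32 by positivity)
      nlinarith [hβsq, Real.sqrt_nonneg (rr ^ 3 * c / 32)]
    rw [div_le_iff₀ (by positivity)]
    nlinarith
  have hbudget := budget_le_pow (t := m + 2) hβ0 hr0 hc0 hratio htL hL16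
  have hfloor : (c * β ^ 4) ^ (m + 2) ≤ traceExcess r.ρ β L (m + 2) := by
    have h1 : (c * β ^ 4) ^ (m + 2) ≤ (c₁ * β ^ 4) ^ (m + 2) :=
      pow_le_pow_left₀ (by positivity) (mul_le_mul_of_nonneg_right hcc₁ (by positivity)) _
    exact h1.trans (hfl β hβpos hββF L hN₀L m)
  have hη : 64 * (L : ℝ) ^ 3 * |(volumeDiscrepancy r.ρ L L' (m + 2) (β : ℂ)).re| ≤ traceExcess r.ρ β L (m + 2) :=
    calc 64 * (L : ℝ) ^ 3 * |(volumeDiscrepancy r.ρ L L' (m + 2) (β : ℂ)).re|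
        ≤ 64 * (L : ℝ) ^ 3 * (24 * ((m + 2 : ℕ) : ℝ) * (β / (rr / 2)) ^ (3 * L)) :=
          mul_le_mul_of_nonneg_left hDabs (by positivity)
      _ ≤ (c * β) ^ L := hbudget
      _ ≤ (c * β ^ 4) ^ (m + 2) := pow_le_floor hc0.le hc1 hβ0 hβ1 htL h4t
      _ ≤ traceExcess r.ρ β L (m + 2) := hfloor
  -- bookkeeping
  have hg'le := log_le_of_discrepancy hLpos hL'L hg0 hDeq hL'pos hη
  have hx'eq : traceExcess r.ρ β L' (m + 2) = Real.exp (Real.log (1 + traceExcess r.ρ β L' (m + 2))) - 1 := by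
    rw [Real.exp_log (by linarith)]; ring
  exact excess_le_of_log_le hx64 hgx hg'le le_rfl hg'0 hx'eq

/-- **Line 7b down to its two hypotheses**: `ThermalFreeEnergyVolumeJets → TraceExcessFloorAllSides → ColdDoublingRecursionSmallCoupling`
(through `coldDoublingRecursionSmallCoupling_of_volumeComparison`).  Only the implication is proved; no mass gap is claimed. -/
theorem coldDoublingRecursionSmallCoupling_of_jets (hJ : ThermalFreeEnergyVolumeJets) (hF : TraceExcessFloorAllSides) :
    ColdDoublingRecursionSmallCoupling :=
  coldDoublingRecursionSmallCoupling_of_volumeComparison (traceExcessVolumeComparisonSmallCoupling_of_jets hJ hF)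

end Summit.QuantumFields.YangMills.Theorems.GlueballBandRecursion.Thermal

end
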